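import Summits.QuantumAdvantage.QuantumAdvantage.Theorems.CharDialPartyDialF2

/-!
# PartyDial (decomp-qadv lens-5 g35), part G1 — §6a: pair separation (cuts anywhere, non-splitting): pair_law 8/9

See part A (`CharDialPartyDialA`) for the node header; memo `NODE-g35.md` (g35 folder of decomp-qadv-lens-5).
-/

set_option autoImplicit false
set_option linter.dupNamespace false

namespace Summit.QuantumAdvantage.QuantumAdvantage.Theorems.PartyDial

open Finset
open Summit.QuantumAdvantage.AdviceFreeQNC0

/-! ## §6  PAIR-SEPARATED strategies: two segments, cuts at ARBITRARY positions.

In §2–§5 the cuts of party `j` sit between the segments (segments `< j` before, `> j` after).  For TWO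
parties that restriction is unnecessary: a cut reading segment `j` may sit anywhere provided it does not
SPLIT the other segment (which then lies entirely before it — phase coefficient `2` — or entirely after
it — coefficient `1`).  Each cut's firing set is still an EVEN function of the foreign class (a unit
multiple of it runs over `ℤ/3`), so each party's aggregate pattern is one of the four `hit a`, and the
two-party table bound `8/9` applies verbatim (`pair_law`).  Consequence (§6d): every strategy of FAN-IN
`≤ ℓ` with `8(ℓ+1)² ≤ n` is pair-separated (two disjoint adjacent pairs of coordinates whose readers do
not interfere exist by counting) — the decided sector now contains all strategies of fan-in `≤ √(n/8) − 1`,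
at any positions (e.g. the reversed wiring `y_g = u_{n−1−g}`, which is not separated in line order). -/

section Pair

variable {n : ℕ} {G : Type*} [Fintype G] (bl : Fin n → ℕ) (pos : G → ℕ) (pty : G → ℕ) (e : G → ℕ)
  (y : G → (Fin n → Bool) → Bool)

/-- the PHASE COEFFICIENT of cut `g` on the foreign segment: `2` if some (hence, for a non-splitting cut,
all) of the foreign segment lies before the cut, else `1`. -/
def cf (g : G) : ℕ :=
  if (univ.filter fun i : Fin n => bl i ≠ pty g ∧ i.val < pos g).Nonempty then 2 else 1

/-- register count of party `j` at foreign class `ψ`, with per-cut coefficients. -/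
def regP (j : ℕ) (u : Fin n → Bool) (ψ : ZMod 3) : ℕ :=
  (univ.filter fun g : G => pty g = j ∧ y g u = true ∧
    ((e g + locA bl j u (pos g) : ℕ) : ZMod 3) + ((cf bl pos pty g : ℕ) : ZMod 3) * ψ ≠ 0).card

/-- pattern of party `j` (party `1`'s phases listed in the order the table game feeds them: `2·w₀`). -/
def patP (j : ℕ) (u : Fin n → Bool) : Fin 4 :=
  if j = 1 then
    encB (decide (regP bl pos pty e y j u 0 % 2 = 1)) (decide (regP bl pos pty e y j u 2 % 2 = 1))
      (decide (regP bl pos pty e y j u 1 % 2 = 1))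
  else
    encB (decide (regP bl pos pty e y j u 0 % 2 = 1)) (decide (regP bl pos pty e y j u 1 % 2 = 1))
      (decide (regP bl pos pty e y j u 2 % 2 = 1))

variable {bl pos pty e y}

omit [Fintype G] in
/-- the coefficient is `1` or `2`. -/
theorem cf_cases (g : G) : cf bl pos pty g = 1 ∨ cf bl pos pty g = 2 := by
  unfold cf; split_ifs <;> simp

/-- a unit multiple of the phase is non-zero at exactly two of the three classes. -/
theorem card_phases_ne_mul (x : ZMod 3) {c : ℕ} (hc : c = 1 ∨ c = 2) :
    (univ.filter fun ψ : ZMod 3 => x + ((c : ℕ) : ZMod 3) * ψ ≠ 0).card = 2 := by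
  rcases hc with rfl | rfl <;> revert x <;> decide

/-- the register counts of a party have an even sum (pair version). -/
theorem regP_sum_even (j : ℕ) (u : Fin n → Bool) :
    (regP bl pos pty e y j u 0 + regP bl pos pty e y j u 1 + regP bl pos pty e y j u 2) % 2 = 0 := by
  classical
  set F := univ.filter fun g : G => pty g = j ∧ y g u = true with hF
  have hreg : ∀ ψ : ZMod 3, regP bl pos pty e y j u ψ =
      ∑ g ∈ F, (if ((e g + locA bl j u (pos g) : ℕ) : ZMod 3) + ((cf bl pos pty g : ℕ) : ZMod 3) * ψ ≠ 0
        then 1 else 0) := by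
    intro ψ
    unfold regP
    rw [← card_filter]
    congr 1
    ext g
    simp [hF, and_assoc]
  have hsum : ∑ ψ : ZMod 3, regP bl pos pty e y j u ψ = ∑ g ∈ F, 2 := by
    simp_rw [hreg]
    rw [Finset.sum_comm]
    refine Finset.sum_congr rfl fun g _ => ?_
    rw [← card_phases_ne_mul (((e g + locA bl j u (pos g) : ℕ) : ZMod 3)) (cf_cases (bl := bl) (pos := pos)
      (pty := pty) g), card_filter]
  have h3 : ∑ ψ : ZMod 3, regP bl pos pty e y j u ψ =
      regP bl pos pty e y j u 0 + regP bl pos pty e y j u 1 + regP bl pos pty e y j u 2 :=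
    Fin.sum_univ_three _
  rw [← h3, hsum, sum_const, smul_eq_mul]
  omega

/-- the even parity triple of a party's registers. -/
theorem regP_xor (j : ℕ) (u : Fin n → Bool) :
    xor (decide (regP bl pos pty e y j u 0 % 2 = 1)) (xor (decide (regP bl pos pty e y j u 1 % 2 = 1))
      (decide (regP bl pos pty e y j u 2 % 2 = 1))) = false := by
  have h := regP_sum_even (bl := bl) (pos := pos) (pty := pty) (e := e) (y := y) j u
  have h2 : decide ((regP bl pos pty e y j u 0 + regP bl pos pty e y j u 1 + regP bl pos pty e y j u 2) % 2 = 1)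
      = false := by
    rw [h]; decide
  rw [SumCodeZero.decide_add_mod_two, SumCodeZero.decide_add_mod_two, Bool.xor_assoc] at h2
  exact h2

/-- the pattern of a party other than `1` reproduces its register parities at the foreign class. -/
theorem hit_patP_ne (j : ℕ) (hj : j ≠ 1) (u : Fin n → Bool) (ψ : ZMod 3) :
    hit (patP bl pos pty e y j u) ψ = decide (regP bl pos pty e y j u ψ % 2 = 1) := by
  unfold patP
  rw [if_neg hj, hit_encB _ _ _ (regP_xor j u) ψ]
  fin_cases ψ <;> rfl

/-- the pattern of party `1`, fed `2·w₀` by the table game, reproduces its register parities at `w₀`. -/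
theorem hit_patP_one (u : Fin n → Bool) (ψ : ZMod 3) :
    hit (patP bl pos pty e y 1 u) (2 * ψ) = decide (regP bl pos pty e y 1 u ψ % 2 = 1) := by
  have hev := regP_xor (bl := bl) (pos := pos) (pty := pty) (e := e) (y := y) 1 u
  have hev' : xor (decide (regP bl pos pty e y 1 u 0 % 2 = 1)) (xor (decide (regP bl pos pty e y 1 u 2 % 2 = 1))
      (decide (regP bl pos pty e y 1 u 1 % 2 = 1))) = false := by
    revert hev
    cases decide (regP bl pos pty e y 1 u 0 % 2 = 1) <;> cases decide (regP bl pos pty e y 1 u 1 % 2 = 1) <;>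
      cases decide (regP bl pos pty e y 1 u 2 % 2 = 1) <;> decide
  unfold patP
  rw [if_pos rfl, hit_encB _ _ _ hev' (2 * ψ)]
  fin_cases ψ <;> rfl

/-- the pattern of party `j` reads only segment `j` (when its cuts do). -/
theorem blockLocal_patP (hy : ∀ g, BlockLocal bl (pty g) (y g)) (j : ℕ) :
    BlockLocal bl j (patP bl pos pty e y j) := by
  have hreg : ∀ (ψ : ZMod 3) (u v : Fin n → Bool), (∀ i, bl i = j → u i = v i) →
      regP bl pos pty e y j u ψ = regP bl pos pty e y j v ψ := by
    intro ψ u v huv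
    unfold regP
    refine congrArg Finset.card (Finset.filter_congr fun g _ => ?_)
    by_cases hg : pty g = j
    · have hyg : y g u = y g v := hy g u v (fun i hi => huv i (hi.trans hg))
      have hl : locA bl j u (pos g) = locA bl j v (pos g) := by
        unfold locA
        rw [blockLocal_bw j u v huv]
        congr 2
        ext i
        simp only [mem_filter, mem_univ, true_and]
        constructor
        · rintro ⟨hi, hlt, hu⟩; exact ⟨hi, hlt, (huv i hi) ▸ hu⟩
        · rintro ⟨hi, hlt, hv⟩; exact ⟨hi, hlt, (huv i hi).symm ▸ hv⟩
      rw [hyg, hl]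
    · simp [hg]
  intro u v huv
  unfold patP
  rw [hreg 0 u v huv, hreg 1 u v huv, hreg 2 u v huv]

/-- phases of the two-party game. -/
theorem phase_two_0 (w : Fin 2 → ZMod 3) : phase w 0 = w 1 := by
  simp [phase, Fin.sum_univ_two]

/-- phases of the two-party game. -/
theorem phase_two_1 (w : Fin 2 → ZMod 3) : phase w 1 = 2 * w 0 := by
  simp [phase, Fin.sum_univ_two]

omit [Fintype G] in
/-- **Address decomposition, pair version**: for a non-splitting cut the foreign segment contributes a UNIT
multiple (`cf g ∈ {1, 2}`) of its class. -/
theorem addr_decompP (hblk : ∀ i, bl i < 2)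
    (hns : ∀ (i i' : Fin n) (g : G), bl i ≠ pty g → bl i' = bl i → (i.val < pos g ↔ i'.val < pos g))
    (g : G) {j j' : ℕ} (hj : pty g = j) (hjj : j + j' = 1) (u : Fin n → Bool) :
    (((e g + walkExp u (pos g) : ℕ) : ZMod 3)) =
      ((e g + locA bl j u (pos g) : ℕ) : ZMod 3) + ((cf bl pos pty g : ℕ) : ZMod 3) * cl bl j' u := by
  classical
  -- the foreign prefix count is all-or-nothing
  have hpre : (univ.filter fun i : Fin n => bl i = j' ∧ i.val < pos g ∧ u i = true).card =
      if (univ.filter fun i : Fin n => bl i ≠ pty g ∧ i.val < pos g).Nonempty then SumCodeZero.bw bl j' u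
      else 0 := by
    split_ifs with hne
    · obtain ⟨i₀, hi₀⟩ := hne
      simp only [mem_filter, mem_univ, true_and] at hi₀
      unfold SumCodeZero.bw
      congr 1; ext i
      simp only [mem_filter, mem_univ, true_and]
      constructor
      · rintro ⟨hi, -, hu⟩; exact ⟨hi, hu⟩
      · rintro ⟨hi, hu⟩
        have hb0 := hblk i₀
        exact ⟨hi, (hns i₀ i g hi₀.1 (by omega)).1 hi₀.2, hu⟩
    · rw [Finset.card_eq_zero, Finset.filter_eq_empty_iff]
      rintro i - ⟨hi, hlt, -⟩
      exact hne ⟨i, by simp only [mem_filter, mem_univ, true_and]; exact ⟨by omega, hlt⟩⟩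
  have hwt : wt u = SumCodeZero.bw bl 0 u + SumCodeZero.bw bl 1 u := by
    rw [wt_eq_sum_bw hblk, Finset.sum_range_succ, Finset.sum_range_succ, Finset.sum_range_zero, zero_add]
  have hwp : wtPrefix u (pos g) = (univ.filter fun i : Fin n => bl i = 0 ∧ i.val < pos g ∧ u i = true).card +
      (univ.filter fun i : Fin n => bl i = 1 ∧ i.val < pos g ∧ u i = true).card := by
    rw [wtPrefix_eq_sum hblk, Finset.sum_range_succ, Finset.sum_range_succ, Finset.sum_range_zero, zero_add]
  have hnat : walkExp u (pos g) = locA bl j u (pos g) + cf bl pos pty g * SumCodeZero.bw bl j' u := by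
    unfold walkExp locA cf
    rw [hwt, hwp]
    rcases Nat.eq_zero_or_pos j with rfl | hjpos
    · have hj' : j' = 1 := by omega
      subst hj'
      rw [hpre]
      split_ifs <;> ring
    · have hj1 : j = 1 := by omega
      have hj' : j' = 0 := by omega
      subst hj1 hj'
      rw [hpre]
      split_ifs <;> ring
  unfold cl
  rw [hnat]
  push_cast
  ring

/-- **WIN = table WIN, pair version** (two parties, arbitrary non-splitting positions). -/
theorem ringWinE_eq_tabWinP (hblk : ∀ i, bl i < 2) (hpty : ∀ g, pty g < 2)
    (hns : ∀ (i i' : Fin n) (g : G), bl i ≠ pty g → bl i' = bl i → (i.val < pos g ↔ i'.val < pos g))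
    (u : Fin n → Bool) :
    ringWinE pos e y u = tabWin (cvec bl 2 u) (fun j => patP bl pos pty e y j.val u) := by
  classical
  have hmod : ∀ x : ℕ, ((x : ZMod 3) ≠ 0) ↔ x % 3 ≠ 0 := by
    intro x
    rw [show (0 : ZMod 3) = ((0 : ℕ) : ZMod 3) from Nat.cast_zero.symm, Ne, ZMod.natCast_eq_natCast_iff']
  -- foreign class of party `j`
  have hS : (univ.filter fun g : G => y g u = true ∧ (e g + walkExp u (pos g)) % 3 ≠ 0).card =
      regP bl pos pty e y 0 u (cl bl 1 u) + regP bl pos pty e y 1 u (cl bl 0 u) := by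
    rw [← Finset.card_filter_add_card_filter_not (s := univ.filter fun g : G =>
      y g u = true ∧ (e g + walkExp u (pos g)) % 3 ≠ 0) (fun g => pty g = 0), filter_filter, filter_filter]
    unfold regP
    congr 1
    · refine congrArg Finset.card (Finset.filter_congr fun g _ => ?_)
      constructor
      · rintro ⟨⟨hy, hne⟩, hj⟩
        refine ⟨hj, hy, ?_⟩
        rw [← addr_decompP (j' := 1) hblk hns g hj (by norm_num) u, hmod]; exact hne
      · rintro ⟨hj, hy, hne⟩
        refine ⟨⟨hy, ?_⟩, hj⟩
        rw [← hmod, addr_decompP (j' := 1) hblk hns g hj (by norm_num) u]; exact hne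
    · refine congrArg Finset.card (Finset.filter_congr fun g _ => ?_)
      have hg1 : ¬ pty g = 0 ↔ pty g = 1 := by have := hpty g; omega
      constructor
      · rintro ⟨⟨hy, hne⟩, hj⟩
        refine ⟨hg1.1 hj, hy, ?_⟩
        rw [← addr_decompP (j' := 0) hblk hns g (hg1.1 hj) (by norm_num) u, hmod]; exact hne
      · rintro ⟨hj, hy, hne⟩
        refine ⟨⟨hy, ?_⟩, hg1.2 hj⟩
        rw [← hmod, addr_decompP (j' := 0) hblk hns g hj (by norm_num) u]; exact hne
  have hcast : ∀ m : ℕ, (if decide (m % 2 = 1) = true then (1 : ZMod 2) else 0) = (m : ZMod 2) := by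
    intro m
    rw [← ZMod.natCast_mod m 2]
    rcases Nat.mod_two_eq_zero_or_one m with h | h <;> simp [h]
  unfold ringWinE tabWin
  rw [hS, Fin.sum_univ_two, phase_two_0, phase_two_1]
  rw [show (fun j : Fin 2 => patP bl pos pty e y j.val u) 0 = patP bl pos pty e y 0 u from rfl,
    show (fun j : Fin 2 => patP bl pos pty e y j.val u) 1 = patP bl pos pty e y 1 u from rfl,
    show cvec bl 2 u 1 = cl bl 1 u from rfl, show cvec bl 2 u 0 = cl bl 0 u from rfl,
    hit_patP_ne 0 (by norm_num), hit_patP_one, hcast, hcast]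
  rw [← Nat.cast_add, Bool.eq_iff_iff]
  simp only [decide_eq_true_eq]
  rw [show (1 : ZMod 2) = ((1 : ℕ) : ZMod 2) from Nat.cast_one.symm, ZMod.natCast_eq_natCast_iff']

/-- the LOSE set of the pair game is the LOSE set of its pattern family. -/
theorem filter_lose_eq_losesP (hblk : ∀ i, bl i < 2) (hpty : ∀ g, pty g < 2)
    (hns : ∀ (i i' : Fin n) (g : G), bl i ≠ pty g → bl i' = bl i → (i.val < pos g ↔ i'.val < pos g)) :
    (univ.filter fun u : Fin n → Bool => ringWinE pos e y u = false) = loses bl 2 (patP bl pos pty e y) := by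
  unfold loses
  refine Finset.filter_congr fun u _ => ?_
  rw [ringWinE_eq_tabWinP hblk hpty hns u]

/-- **The pair law (core form)**: two segments of length `≥ m₀ ≥ 1`, every cut reads one segment and does
not split the other, ARBITRARY positions and charges: at most `(1 − γ(m₀)²)·2ⁿ` winning inputs. -/
theorem pair_law_core {bl : Fin n → ℕ} (pos : G → ℕ) {pty : G → ℕ} (e : G → ℕ)
    (y : G → (Fin n → Bool) → Bool)
    (hblk : ∀ i, bl i < 2) (hpty : ∀ g, pty g < 2)
    (hns : ∀ (i i' : Fin n) (g : G), bl i ≠ pty g → bl i' = bl i → (i.val < pos g ↔ i'.val < pos g))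
    (hy : ∀ g, BlockLocal bl (pty g) (y g))
    {m₀ : ℕ} (hm₀ : 1 ≤ m₀) (hsize : ∀ j < 2, m₀ ≤ (univ.filter fun i : Fin n => bl i = j).card) :
    ((univ.filter fun u : Fin n → Bool => ringWinE pos e y u = true).card : ℝ) ≤
      (1 - gam m₀ ^ 2) * (2 : ℝ) ^ n := by
  classical
  have hγ : ∀ j < 2, ∀ r : ZMod 3, gam m₀ * (2 : ℝ) ^ n ≤
      ((univ.filter fun u : Fin n → Bool => cl bl j u = r).card : ℝ) := by
    intro j hj r
    rw [card_cl_eq]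
    exact SumCodeZero.gamma_mul_le_card_cls j (hsize j hj) r.val (ZMod.val_lt r)
  have hloss := pattern_law 2 8 nWins_two_le (patP bl pos pty e y) (blockLocal_patP (pos := pos) (e := e) hy)
    (fun _ => gam m₀) (fun _ _ => gam_nonneg hm₀) hγ
  rw [prod_const, card_range, ← filter_lose_eq_losesP hblk hpty hns] at hloss
  have hsplit := card_filter_add_card_filter_not (s := (univ : Finset (Fin n → Bool)))
    (fun u : Fin n → Bool => ringWinE pos e y u = true)
  simp only [card_univ, Fintype.card_fun, Fintype.card_bool, Fintype.card_fin, Bool.not_eq_true] at hsplit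
  have hs : (((univ.filter fun u : Fin n → Bool => ringWinE pos e y u = true).card : ℕ) : ℝ) +
      (((univ.filter fun u : Fin n → Bool => ringWinE pos e y u = false).card : ℕ) : ℝ) = (2 : ℝ) ^ n := by
    exact_mod_cast hsplit
  norm_num at hloss
  linarith

end Pair

end Summit.QuantumAdvantage.QuantumAdvantage.Theorems.PartyDial
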